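import Literature.Probability.LatticeModels.ObservableContinuumBounds
import Literature.Probability.LatticeModels.InnerFacesHoleFree
import HarnessLib

/-!
# Lattice arcs `(ab)`, `(ba)` as paths, and the analytic hypotheses `ObsHyp`

Topic `Literature/Probability/LatticeModels`; an instalment (item G0(i) of the road recorded in
`Sweep1Proofs.lean`, module docstring §2b) of the discharge programme for crit-ising.S18 /
Smirnov's Theorem 2.2. Smirnov's discrete domains `Ω_δ` are simply connected lattice domains
*given as unions of squares whose boundary consists of two lattice arcs* `(ab)` and `(ba)`
(Smirnov 2010, §2.2 and §3). The tree's `meshDomain` (largest vertex component of `D ∩ δℤ²`,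
edges the unit segments in `D̄`) is more general: for wild Jordan curves it may carry labelled
blobs attached through an uncoloured vertex and arc-coloured filament edges bordering no inner
face, configurations outside the scope of the source (see the module docstring of the corrected
statement). This file isolates the source's hypothesis in tree vocabulary —
`DiscreteDobrushin.HasArcPaths`: each discrete arc is connected through edges of `Ω_δ`, and every
edge of `Ω_δ` joining two sites of the same arc borders an inner face — and derives from it, for
admissible data on a Jordan domain, the analytic hypotheses `ObsHyp` of the convergence
programme (`ObsHyp.of_hasArcPaths`): an FK primitive exists (`exists_isFKPrimitive`, hole-freeness
of the inner faces `holeFree_innerFaces`) and is constant on each arc (`hw_eq_hw_of_arcA` along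
`A`-paths, `hb_eq_hw_of_mem_zdArcB` at both ends of `B`–`B` edges). Everything is proved.

## References

* S. Smirnov, Ann. of Math. 172 (2010) 1435–1467, §2.2, §3, Lemma 4.11 — bib key `Smirnov2010`.
-/

noncomputable section

namespace Literature.Probability.LatticeModels

open Set

namespace DiscreteDobrushin

/-- **The discrete arcs are lattice paths bordering the domain** (Smirnov's setting): the wired
arc `A` and the free arc `B` each induce a connected subgraph of `Ω_δ`, and every edge of `Ω_δ`
joining two sites of the same arc is a side of an inner face. [cite: Smirnov2010, §2.2 and §3 (boundary arcs of the lattice domain)] -/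
structure HasArcPaths (E : DiscreteDobrushin) : Prop where
  /-- The wired arc is connected through edges of `Ω_δ`. -/
  arcA : ((discreteDomainGraph E.Ω E.δ).induce E.zdArcA).Preconnected
  /-- The free arc is connected through edges of `Ω_δ`. -/
  arcB : ((discreteDomainGraph E.Ω E.δ).induce E.zdArcB).Preconnected
  /-- An edge of `Ω_δ` between two `A`-sites borders an inner face. -/
  inner_of_arcA : ∀ (u : Site 2) (k : Fin 4), u ∈ E.zdArcA → u + cornerUnit k ∈ E.zdArcA →
    (discreteDomainGraph E.Ω E.δ).Adj u (u + cornerUnit k) → E.IsInnerFace (faceAt u k) ∨ E.IsInnerFace (faceAt u (k + 3))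
  /-- An edge of `Ω_δ` between two `B`-sites borders an inner face. -/
  inner_of_arcB : ∀ (u : Site 2) (k : Fin 4), u ∈ E.zdArcB → u + cornerUnit k ∈ E.zdArcB →
    (discreteDomainGraph E.Ω E.δ).Adj u (u + cornerUnit k) → E.IsInnerFace (faceAt u k) ∨ E.IsInnerFace (faceAt u (k + 3))

end DiscreteDobrushin

/-! ### Constancy of the primitive along the arcs -/

section Constancy

variable {E : DiscreteDobrushin} [Fintype (meshDomain E.Ω E.δ)] {hE : E.IsZdAdmissible} {Hw Hb : Site 2 → ℝ}

/-- Adjacent sites of `ℤ²` differ by a unit vector. [folklore] -/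
theorem exists_eq_add_cornerUnit_of_adj {u v : Site 2} (h : (zdGraph 2).Adj u v) : ∃ k : Fin 4, v = u + cornerUnit k := by
  rcases (zdGraph_adj_iff u v).1 h with ⟨i, hi | hi⟩
  · fin_cases i
    · exact ⟨0, by rw [hi]; rfl⟩
    · exact ⟨1, by rw [hi]; rfl⟩
  · fin_cases i
    · exact ⟨2, by rw [hi]; simp [cornerUnit]⟩
    · exact ⟨3, by rw [hi]; simp [cornerUnit]⟩

/-- A function constant across the edges of a preconnected induced subgraph is constant on it.
[folklore] -/
theorem const_of_preconnected_induce {V : Set (Site 2)} {G : SimpleGraph (Site 2)} (hV : (G.induce V).Preconnected)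
    {f : Site 2 → ℝ} (hf : ∀ u ∈ V, ∀ v ∈ V, G.Adj u v → f u = f v) {u v : Site 2} (hu : u ∈ V) (hv : v ∈ V) :
    f u = f v := by
  obtain ⟨p⟩ := hV ⟨u, hu⟩ ⟨v, hv⟩
  -- induct over a walk between arbitrary vertices of the subtype
  suffices key : ∀ (a b : V) (q : (G.induce V).Walk a b), f a = f b from key ⟨u, hu⟩ ⟨v, hv⟩ p
  intro a b q
  induction q with
  | nil => rfl
  | @cons a b c hab _ ih => exact (hf a a.2 b b.2 hab).trans ih

/-- **`Hw` is constant on the wired arc** when the arc is a lattice path (`HasArcPaths`).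
[cite: Smirnov2010, Lemma 3.10 / Lemma 4.11 (H constant on (ab))] -/
theorem IsFKPrimitive.hw_const_arcA (h : IsFKPrimitive E hE Hw Hb) (hP : E.HasArcPaths) {u v : Site 2}
    (hu : u ∈ E.zdArcA) (hv : v ∈ E.zdArcA) : Hw u = Hw v := by
  refine const_of_preconnected_induce hP.arcA (fun x hx y hy hxy => ?_) hu hv
  have hzd : (zdGraph 2).Adj x y := meshGraph_le_zdGraph _ _ (discreteDomainGraph_le_meshGraph _ _ hxy)
  obtain ⟨k, rfl⟩ := exists_eq_add_cornerUnit_of_adj hzd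
  exact h.hw_eq_hw_of_arcA hx hy (hP.inner_of_arcA x k hx hy hxy)

/-- **`Hw` is constant on the free arc** when the arc is a lattice path: at both endpoints of a
`B`–`B` edge with an inner face `F`, `Hw = Hb F` (zero flux on `B`).
[cite: Smirnov2010, Lemma 3.10 / Lemma 4.11 (H constant on (ba))] -/
theorem IsFKPrimitive.hw_const_arcB (h : IsFKPrimitive E hE Hw Hb) (hP : E.HasArcPaths) {u v : Site 2}
    (hu : u ∈ E.zdArcB) (hv : v ∈ E.zdArcB) : Hw u = Hw v := by
  refine const_of_preconnected_induce hP.arcB (fun x hx y hy hxy => ?_) hu hv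
  have hzd : (zdGraph 2).Adj x y := meshGraph_le_zdGraph _ _ (discreteDomainGraph_le_meshGraph _ _ hxy)
  obtain ⟨k, rfl⟩ := exists_eq_add_cornerUnit_of_adj hzd
  rcases hP.inner_of_arcB x k hx hy hxy with hf | hf
  · have h1 := h.hb_eq_hw_of_mem_zdArcB hx hf
    have hf' : E.IsInnerFace (faceAt (x + cornerUnit k) (k + 1)) := by rw [faceAt_add_unit_succ]; exact hf
    have h2 := h.hb_eq_hw_of_mem_zdArcB hy hf'
    rw [faceAt_add_unit_succ] at h2
    linarith
  · have h1 := h.hb_eq_hw_of_mem_zdArcB hx hf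
    have e : faceAt (x + cornerUnit k) (k + 2) = faceAt x (k + 3) := by
      ext i; fin_cases i <;> fin_cases k <;> simp [faceAt, cornerOff, cornerUnit] <;> ring
    have hf' : E.IsInnerFace (faceAt (x + cornerUnit k) (k + 2)) := by rw [e]; exact hf
    have h2 := h.hb_eq_hw_of_mem_zdArcB hy hf'
    rw [e] at h2
    linarith

end Constancy

/-! ### The analytic hypotheses from lattice arcs -/

/-- **`ObsHyp` holds for admissible data on a Jordan domain whose discrete arcs are lattice
paths.** [cite: Smirnov2010, §2.2, §3 and Lemma 4.11] -/
theorem ObsHyp.of_hasArcPaths (D : RandomPlanarGeometry.JordanDomain) {E : DiscreteDobrushin} (hΩ : E.Ω = D.carrier)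
    (hE : E.IsZdAdmissible) (hP : E.HasArcPaths) : ObsHyp E := by
  letI := E.admFintype hE
  obtain ⟨Hw, Hb, h⟩ := exists_isFKPrimitive hE hP.arcA (holeFree_innerFaces D hΩ hE.delta_pos)
  have hc₀ := DiscreteDobrushin.isStartCorner_startCorner hE
  refine ⟨hE, hP.arcA, Hw, Hb, h, fun a' ha' _ => h.hw_const_arcA hP ha' hc₀.mem_zdArcA,
    fun b hb _ => h.hw_const_arcB hP hb hc₀.mem_zdArcB⟩

end Literature.Probability.LatticeModels
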